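import Literature.AlgebraicGeometry.Resolution.KunzRegularityCriterionFlat
import Literature.AlgebraicGeometry.Resolution.KunzRegularityCriterionLech
import Literature.RingTheory.HilbertSamuel.PhiUpperBound
import Mathlib.Algebra.Module.SpanRank
import Mathlib.Data.Nat.Choose.Bounds
import HarnessLib

/-!
# Kunz's regularity criterion: the discharge `Kunz1969_holds` (Kunz 1969, Thm. 2.1)

E. Kunz, *Characterizations of regular local rings of characteristic `p`*, Amer. J. Math. 91
(1969) 772–784, Thm. 2.1, in the local Frobenius-flat phrasing of The Stacks Project, Tag 0EC0
(Lemma 51.17.6 "(Kunz)"): *for a Noetherian local ring `R` of prime characteristic `p`, the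
Frobenius `a ↦ a ^ p` is flat if and only if `R` is regular* — the named fact
`Literature.AlgebraicGeometry.Resolution.Kunz1969` of `KunzRegularityCriterion.lean`, proved
here (`Kunz1969_holds`). The direction "regular ⇒ flat" is
`flat_frobenius_of_isRegularLocalRing` (`KunzRegularityCriterionFlat.lean`); this file proves
"flat ⇒ regular" (`Kunz1969.isRegularLocalRing_of_flat_frobenius`) following the printed proof
of Tag 0EC0:

> "Conversely, assume `F` is flat. Write `𝔪 = (x₁, …, x_r)` with `r` minimal. Then `x₁, …, x_r`
> are independent in the sense defined above. Since `F` is flat, we see that `x₁^p, …, x_r^p`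
> are independent, see Lemma 0EBZ. Hence `length_A(A/(x₁^p, …, x_r^p)) = p^r` by Lemma 0EBY.
> Let `χ(n) = length_A(A/𝔪ⁿ)` and recall that this is a numerical polynomial of degree
> `dim(A)` […] `𝔪^{pn+pr} ⊂ F(𝔪ⁿ)A ⊂ 𝔪^{pn}` […] We conclude `χ(pn + pr) ≥ p^rχ(n) ≥ χ(pn)`.
> Looking at the leading terms this implies `r = dim(A)`, i.e., `A` is regular."

with one simplification in the last step: instead of the Hilbert–Samuel POLYNOMIAL and a fixed
`p` we use `n = 1` and all the powers `q = p^e` (the iterates `F^e` are flat as well):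
`q^r = ℓ(A/(x₁^q, …, x_r^q)) ≤ ℓ(A/𝔪^{rq+1}) ≤ c · binom(rq + d, d)` for all `q = p^e`, where
`d = dim A` and the last inequality is the elementary upper bound for the Hilbert–Samuel
FUNCTION through a system of parameters
(`Literature.RingTheory.HilbertSamuel.exists_hilbertSamuelFun_one_le_smul`, CJS Lemma 2.14);
letting `e → ∞` gives `r ≤ d`, i.e. `A` is regular. The Lech lemmas 0EBW–0EBZ are in
`KunzRegularityCriterionLech.lean`.

* `Kunz1969.indep_of_span_eq_maximalIdeal` — a minimal system of generators of `𝔪` is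
  independent ("`x₁, …, x_r` are independent": a relation with a unit coefficient would drop a
  generator).
* `Kunz1969.pow_span_le_span_pow` — `(x₁, …, x_r)^{rq+1} ⊆ (x₁^q, …, x_r^q)` ("as can be seen by
  looking at monomials").
* `Kunz1969.length_quotient_frobeniusPower_eq` — `ℓ(A/(x₁^q, …, x_r^q)) = q^r` for `F` flat.
* `Kunz1969.isRegularLocalRing_of_flat_frobenius`, `Kunz1969_holds`.

## References

* [Kunz1969] E. Kunz, Amer. J. Math. 91 (1969) 772–784, Thm. 2.1.
* [StacksProject] Tag 0EC0 (Lemma 51.17.6 (Kunz)) with Tags 0EBW–0EBZ.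
* [CossartJannsenSaito2020] Lemma 2.14 (b) (the bound `H^{(1)}_A ≤ c · Φ^{(d+1)}`).
-/

namespace Literature.AlgebraicGeometry.Resolution

universe u

open IsLocalRing Function Literature.RingTheory.HilbertSamuel

namespace Kunz1969

variable {A : Type u} [CommRing A]

/-! ### Iterates of a flat Frobenius are flat -/

/-- If the Frobenius of `A` is flat then so is its `n`-th iterate `a ↦ a^{pⁿ}` (composition of
flat ring maps). [folklore] -/
theorem flat_iterateFrobenius {p : ℕ} [ExpChar A p] (h : (frobenius A p).Flat) (n : ℕ) :
    (iterateFrobenius A p n).Flat := by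
  induction n with
  | zero => rw [iterateFrobenius_zero]; exact RingHom.Flat.id A
  | succ n ih => rw [iterateFrobenius_add, iterateFrobenius_one]; exact h.comp ih

/-! ### Minimal generators of the maximal ideal -/

/-- An ideal of a Noetherian ring is generated by a family indexed by `Fin (spanFinrank I)`
("write `𝔪 = (x₁, …, x_r)` with `r` minimal"). [folklore] -/
theorem exists_span_range_eq [IsNoetherianRing A] (I : Ideal A) :
    ∃ x : Fin I.spanFinrank → A, Ideal.span (Set.range x) = I := by
  obtain ⟨s, hcard, hspan⟩ :=
    Submodule.FG.exists_span_finset_card_eq_spanFinrank (IsNoetherian.noetherian I)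
  refine ⟨fun i => (s.equivFin.symm (Fin.cast hcard.symm i) : A), ?_⟩
  have hx : Set.range (fun i => (s.equivFin.symm (Fin.cast hcard.symm i) : A)) = ↑s := by
    ext a
    simp only [Set.mem_range, Finset.mem_coe]
    constructor
    · rintro ⟨i, rfl⟩
      exact (s.equivFin.symm _).2
    · intro ha
      exact ⟨Fin.cast hcard (s.equivFin ⟨a, ha⟩), by simp⟩
  rw [hx]
  exact hspan

/-- **A minimal system of generators of the maximal ideal is independent** (Stacks 0EC0:
"`x₁, …, x_r` are independent in the sense defined above"): if `𝔪 = (x₁, …, x_r)` with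
`r = spanFinrank 𝔪` and `∑ aᵢxᵢ = 0`, then every `aᵢ ∈ 𝔪` — otherwise `a_j` is a unit, `x_j` is
a combination of the other `xᵢ`, and `𝔪` is generated by `r - 1` elements.
[cite: StacksProject, Tag 0EC0 (proof)] -/
theorem indep_of_span_eq_maximalIdeal [IsLocalRing A] {r : ℕ} (x : Fin r → A)
    (hx : Ideal.span (Set.range x) = maximalIdeal A) (hr : (maximalIdeal A).spanFinrank = r) :
    ∀ a : Fin r → A, ∑ i, a i * x i = 0 → ∀ i, a i ∈ Ideal.span (Set.range x) := by
  intro a ha j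
  rw [hx]
  by_contra hj
  have hu : IsUnit (a j) := by
    by_contra hna
    exact hj ((IsLocalRing.mem_maximalIdeal _).mpr (mem_nonunits_iff.mpr hna))
  obtain ⟨v, hv⟩ := hu.exists_left_inv
  -- `x_j` is a combination of the `xᵢ`, `i ≠ j`
  set E : Finset (Fin r) := Finset.univ.erase j with hE
  have hsplit : a j * x j + ∑ i ∈ E, a i * x i = 0 := by
    rwa [sum_mul_eq_add_sum_erase a x j] at ha
  have hxj : x j ∈ Ideal.span (x '' (E : Set (Fin r))) := by
    have heq : x j = -(v * ∑ i ∈ E, a i * x i) := by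
      linear_combination (-(x j)) * hv + v * hsplit
    rw [heq]
    refine Submodule.neg_mem _ (Ideal.mul_mem_left _ _ (Submodule.sum_mem _ fun i hi => ?_))
    exact Ideal.mul_mem_left _ _
      (Ideal.subset_span (Set.mem_image_of_mem x (Finset.mem_coe.mpr hi)))
  -- hence `𝔪 = (xᵢ, i ≠ j)` is generated by `r - 1` elements
  have hle : maximalIdeal A ≤ Ideal.span (x '' (E : Set (Fin r))) := by
    rw [← hx]
    refine Ideal.span_le.mpr (Set.range_subset_iff.mpr fun i => ?_)
    by_cases hi : i = j
    · rw [hi]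
      exact hxj
    · exact Ideal.subset_span (Set.mem_image_of_mem x
        (Finset.mem_coe.mpr (Finset.mem_erase.mpr ⟨hi, Finset.mem_univ i⟩)))
  have hge : Ideal.span (x '' (E : Set (Fin r))) ≤ maximalIdeal A := by
    rw [← hx]
    exact Ideal.span_mono (Set.image_subset_range x _)
  have heq : maximalIdeal A = Ideal.span (x '' (E : Set (Fin r))) := le_antisymm hle hge
  have hcard : (maximalIdeal A).spanFinrank ≤ r - 1 :=
    calc (maximalIdeal A).spanFinrank
        = (Ideal.span (x '' (E : Set (Fin r)))).spanFinrank := by rw [← heq]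
      _ ≤ (x '' (E : Set (Fin r))).ncard :=
          Submodule.spanFinrank_span_le_ncard_of_finite (E.finite_toSet.image x)
      _ ≤ (E : Set (Fin r)).ncard := Set.ncard_image_le E.finite_toSet
      _ = E.card := Set.ncard_coe_finset E
      _ = r - 1 := by
          rw [hE, Finset.card_erase_of_mem (Finset.mem_univ j), Finset.card_univ, Fintype.card_fin]
  have hpos : 0 < r := Fin.pos j
  omega

/-! ### `𝔪^{rq+1} ⊆ 𝔪^{[q]}` -/

/-- **Monomial pigeonhole**: for a finite family `(xᵢ)_{i ∈ s}`,
`(xᵢ : i ∈ s)^{#s·q + 1} ⊆ (xᵢ^q : i ∈ s)` (Stacks 0EC0: "as can be seen by looking at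
monomials in `x₁, …, x_r`"; here by induction on `s` through
`(I ⊔ J)^{n+m} ≤ Iⁿ ⊔ Jᵐ`). [cite: StacksProject, Tag 0EC0 (proof)] -/
theorem pow_span_image_le_span_image_pow {ι : Type*} [DecidableEq ι] (x : ι → A) (q : ℕ)
    (s : Finset ι) :
    Ideal.span (x '' (s : Set ι)) ^ (s.card * q + 1) ≤
      Ideal.span ((fun i => x i ^ q) '' (s : Set ι)) := by
  induction s using Finset.induction_on with
  | empty =>
    rw [Finset.coe_empty, Set.image_empty, Set.image_empty, Ideal.span_empty, Finset.card_empty,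
      zero_mul, zero_add, pow_one]
  | insert a s ha ih =>
    rw [Finset.coe_insert, Set.image_insert_eq, Set.image_insert_eq, Ideal.span_insert,
      Ideal.span_insert, Finset.card_insert_of_notMem ha,
      show (s.card + 1) * q + 1 = q + (s.card * q + 1) by ring]
    exact Ideal.sup_pow_add_le_pow_sup_pow.trans
      (sup_le_sup (Ideal.span_singleton_pow (x a) q).le ih)

/-- `(x₁, …, x_r)^{rq+1} ⊆ (x₁^q, …, x_r^q)`. [cite: StacksProject, Tag 0EC0 (proof)] -/
theorem pow_span_le_span_pow {r : ℕ} (x : Fin r → A) (q : ℕ) :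
    Ideal.span (Set.range x) ^ (r * q + 1) ≤ Ideal.span (Set.range fun i => x i ^ q) := by
  have h := pow_span_image_le_span_image_pow x q Finset.univ
  rwa [Finset.coe_univ, Set.image_univ, Set.image_univ, Finset.card_univ, Fintype.card_fin] at h

/-! ### `ℓ(A/𝔪^{[q]}) = q^r` when the Frobenius is flat -/

/-- **`length_A(A/(x₁^q, …, x_r^q)) = q^r`** for `q = pⁿ` when the Frobenius of the local ring
`(A, 𝔪)` of characteristic `p` is flat and `𝔪 = (x₁, …, x_r)` minimally (Stacks 0EC0: "Since
`F` is flat, we see that `x₁^p, …, x_r^p` are independent, see Lemma 0EBZ. Hence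
`length_A(A/(x₁^p, …, x_r^p)) = p^r` by Lemma 0EBY", applied to the flat iterate `Fⁿ`).
[cite: StacksProject, Tag 0EC0 (proof)] -/
theorem length_quotient_frobeniusPower_eq [IsLocalRing A] {p : ℕ} [Fact p.Prime] [CharP A p]
    (hF : (frobenius A p).Flat) {r : ℕ} (x : Fin r → A)
    (hx : Ideal.span (Set.range x) = maximalIdeal A) (hr : (maximalIdeal A).spanFinrank = r)
    (n : ℕ) :
    Module.length A (A ⧸ Ideal.span (Set.range fun i => x i ^ p ^ n)) =
      (((p ^ n) ^ r : ℕ) : ℕ∞) := by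
  have hind := indep_of_span_eq_maximalIdeal x hx hr
  have hind' := indep_map_of_flat (iterateFrobenius A p n) (flat_iterateFrobenius hF n) hind
  simp only [iterateFrobenius_def] at hind'
  have hm : (Ideal.span (Set.range x)).IsMaximal := hx ▸ IsLocalRing.maximalIdeal.isMaximal A
  rw [length_quotient_pow_eq_prod x hm (fun _ => p ^ n)
    (fun _ => Nat.one_le_pow _ _ (Fact.out : p.Prime).pos) hind',
    Finset.prod_const, Finset.card_univ, Fintype.card_fin]

/-! ### Flat Frobenius ⇒ regular -/

/-- **The count** (Stacks 0EC0, end of the proof, with `n = 1` and all `q = pⁿ`): if the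
Frobenius of the Noetherian local ring `(A, 𝔪)` of characteristic `p` is flat,
`𝔪 = (x₁, …, x_r)` minimally and `dim A = d`, then `r ≤ d` — since
`q^r = ℓ(A/(x₁^q, …, x_r^q)) ≤ ℓ(A/𝔪^{rq+1}) ≤ c · binom(rq + d, d) ≤ c (r+d)^d q^d` for all
`q = pⁿ`. [cite: StacksProject, Tag 0EC0 (proof)] -/
theorem spanFinrank_le_of_flat_frobenius [IsLocalRing A] [IsNoetherianRing A] {p : ℕ}
    [Fact p.Prime] [CharP A p] (hF : (frobenius A p).Flat) {r : ℕ} (x : Fin r → A)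
    (hx : Ideal.span (Set.range x) = maximalIdeal A) (hr : (maximalIdeal A).spanFinrank = r)
    {d : ℕ} (hd : ringKrullDim A = d) : r ≤ d := by
  obtain ⟨c, -, hc⟩ := exists_hilbertSamuelFun_one_le_smul A hd
  -- `(pⁿ)^r ≤ c · binom(r pⁿ + d, d)` for every `n`
  have key : ∀ n : ℕ, (p ^ n) ^ r ≤ c * (r * p ^ n + d).choose d := by
    intro n
    have h1 := length_quotient_frobeniusPower_eq hF x hx hr n
    have h2 : Module.length A (A ⧸ Ideal.span (Set.range fun i => x i ^ p ^ n)) ≤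
        Module.length A (A ⧸ maximalIdeal A ^ (r * p ^ n + 1)) :=
      Module.length_le_of_surjective (Submodule.factor (hx ▸ pow_span_le_span_pow x (p ^ n)))
        (Submodule.factor_surjective _)
    have h3 := hilbertSamuelFun_one_eq_length A (r * p ^ n)
    have h4 : hilbertSamuelFun A 1 (r * p ^ n) ≤ c * (r * p ^ n + d).choose d := by
      have := hc (r * p ^ n)
      rwa [Pi.smul_apply, smul_eq_mul, iterPSum_succ_Phi_eq_choose] at this
    have h5 : (((p ^ n) ^ r : ℕ) : ℕ∞) ≤ ((c * (r * p ^ n + d).choose d : ℕ) : ℕ∞) := by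
      rw [← h1]
      refine h2.trans ?_
      rw [← h3]
      exact_mod_cast h4
    exact_mod_cast h5
  -- asymptotics in `n`
  by_contra hrd
  push Not at hrd
  have hp : 1 < p := (Fact.out : p.Prime).one_lt
  set M : ℕ := c * (r + d) ^ d with hM
  have hQ : M < p ^ M := Nat.lt_pow_self hp
  set Q : ℕ := p ^ M with hQdef
  have hQpos : 0 < Q :=
    Nat.pos_of_ne_zero (by rw [hQdef]; exact pow_ne_zero _ (Fact.out : p.Prime).ne_zero)
  have h1 : Q ^ (d + 1) ≤ Q ^ r := Nat.pow_le_pow_right hQpos hrd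
  have h2 : (r * Q + d).choose d ≤ (r * Q + d) ^ d := Nat.choose_le_pow _ _
  have h3 : r * Q + d ≤ (r + d) * Q := by nlinarith
  have h4 : c * (r * Q + d).choose d ≤ M * Q ^ d :=
    calc c * (r * Q + d).choose d ≤ c * (r * Q + d) ^ d := Nat.mul_le_mul_left c h2
      _ ≤ c * ((r + d) * Q) ^ d := Nat.mul_le_mul_left c (Nat.pow_le_pow_left h3 d)
      _ = M * Q ^ d := by rw [mul_pow, hM, mul_assoc]
  have h5 : Q ^ d * Q ≤ Q ^ d * M := by
    calc Q ^ d * Q = Q ^ (d + 1) := (pow_succ Q d).symm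
      _ ≤ Q ^ r := h1
      _ ≤ c * (r * Q + d).choose d := key M
      _ ≤ M * Q ^ d := h4
      _ = Q ^ d * M := mul_comm _ _
  have h6 : Q ≤ M := Nat.le_of_mul_le_mul_left h5 (pow_pos hQpos d)
  omega

/-- **Kunz's theorem, direction "flat ⇒ regular"** (Kunz 1969, Thm. 2.1, (2) ⇒ (1); The Stacks
Project, Tag 0EC0): a Noetherian local ring of prime characteristic `p` whose Frobenius
endomorphism is flat is a regular local ring (`spanFinrank 𝔪 ≤ dim A` by
`spanFinrank_le_of_flat_frobenius` for a minimal system of generators of `𝔪`).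
[cite: Kunz1969, Thm. 2.1 (2) ⇒ (1)] -/
theorem isRegularLocalRing_of_flat_frobenius (p : ℕ) [Fact p.Prime] (A : Type u) [CommRing A]
    [IsLocalRing A] [IsNoetherianRing A] [CharP A p] (hF : (frobenius A p).Flat) :
    IsRegularLocalRing A := by
  obtain ⟨d, hd⟩ := exists_nat_cast_eq_ringKrullDim (R := A)
  obtain ⟨x, hx⟩ := exists_span_range_eq (maximalIdeal A)
  apply IsRegularLocalRing.of_spanFinrank_maximalIdeal_le
  rw [hd]
  exact_mod_cast spanFinrank_le_of_flat_frobenius hF x hx rfl hd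

end Kunz1969

/-- **Kunz's regularity criterion** (E. Kunz 1969, Thm. 2.1; The Stacks Project, Tag 0EC0,
Lemma 51.17.6 "(Kunz)"), discharging the named fact `Kunz1969`: for a Noetherian local ring `R`
of prime characteristic `p`, the Frobenius endomorphism `frobenius R p` is flat if and only if
`R` is a regular local ring. `⇒`: `Kunz1969.isRegularLocalRing_of_flat_frobenius` (Lech's
independence lemmas and the Hilbert–Samuel bound); `⇐`: `flat_frobenius_of_isRegularLocalRing`
(Matsumura's slicing argument for Thm. 23.1). [cite: Kunz1969, Thm. 2.1] -/
theorem Kunz1969_holds : Kunz1969 := by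
  intro p _ R _ _ _ _
  exact ⟨fun hF => Kunz1969.isRegularLocalRing_of_flat_frobenius p R hF,
    fun hR => flat_frobenius_of_isRegularLocalRing p R⟩

end Literature.AlgebraicGeometry.Resolution
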